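import Mathlib
import HarnessLib
import Summits.Ventures.LatticeQCDFlow.Exactness.SUNMetropolisORSweepErgodic
import Summits.Ventures.LatticeQCDFlow.Exactness.SUNWilsonForceLaw

/-!
# The engine's `'hmc' + n_or × 'or'` composite on `SU(N)` lattice gauge fields converges to the Wilson measure from every start, for short trajectories

HONEST FRAMING: exact (Metropolis-corrected) sampling algorithms for lattice gauge theory;
figures of merit are autocorrelation/cost numbers at stated couplings and volumes; no
continuum-physics claim.

Venture `LatticeQCDFlow` (cell pub-lqcd), topic `Exactness`, FANOUT row 9 (eng-latcore, the engine
`latflow.core.updates.composite_sweep(f, β, 'hmc', n_or)` on `SU(N)`: one `n`-step leapfrog HMC update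
(`SUNMultiStepLeapfrogHMC.sunLeapfrogHMCN` in the engine's coordinates, gen-18/19) followed by `n_or`
Cabibbo–Marinari over-relaxation sweeps (`CabibboMarinariORSweep.cmORSweep`)).  NEW WORK of the cell over
the tree (`ExactStepBoxMinorised.lean`: a box-minorised exact update composed with any exact Markov kernel
converges from every start; `SUNMultiStepLeapfrogHMCErgodic.sunLeapfrogHMCN_minorised_walk`: for short
trajectories one HMC update dominates the walk with the product chart kick; `SUNMultiStepPositionLaw.chartKickR`;
`SUNExpChartMinorisation.exists_smul_haar_restrict_le_map_suExp`: the chart dominates Haar near `1`;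
`SUNMultiStepLeapfrogHMCEngine`: the engine's coordinates / kinetic term / trajectory-length arithmetic;
`SUNForceRegularity` + `SUNWilsonForceLaw`: the engine's Wilson force is a `C¹` law with bounds;
`SUNMetropolisORSweepErgodic.cmORSweep_invariant_gibbsProbability`; `SUNLeapfrogHMCWilson`).  Nothing is
cited as a fact; no number is claimed.

* (the chart-kick minorant `exists_smul_haar_restrict_le_chartKickR` is `KickLawsNearIdentity.lean`.)
* **`engine_sunLeapfrogHMCN_exactStep_uniformlyErgodic`** — `N ≥ 1`, finite link set, `n ≥ 1` leapfrog
  steps of size `ε > 0` in the engine's coordinates with kinetic term `−Σ tr P²`, a measurable increment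
  bounded by `b` per link and `K_g`-Lipschitz, a measurable action bounded by `s`, and the short-trajectory
  conditions `nε, (2n+1)b, K_g εn² ≤ s_N` of gen-18; `P` ANY Markov kernel leaving `π_S = Z⁻¹e^{−S}·Haar^{⊗}`
  invariant: the composite "HMC update, then `P`" satisfies `|μ₀Kᵗ(A) − π_S(A)| ≤ (1 − δ)^{⌊t/(mm+1)⌋}` for
  some `mm`, `δ ∈ (0, 1]`, EVERY initial law, every `t`, every `A`, and `π_S` is its unique invariant
  probability law.
* **`engine_sunLeapfrogHMCN_exactStep_uniformlyErgodic_of_contDiff`** — the same for any `C¹` ambient force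
  law `F` (half kick `−(ε/2)F`), in trajectory-length form: `∃ τ₀ > 0`, every `n ≥ 1`, `ε > 0` with `nε ≤ τ₀`.
* **`wilson_sunWilsonForceHMCN_orSweep_uniformlyErgodic`** — THE ENGINE'S COMPOSITE AS RUN: torus `(ℤ/L)^d`,
  `L ≥ 2`, `SU(N)` with the engine's Wilson force `(β/2N)·TA(U_e R_e)`, action `(β/N)·S_W`, ANY schedule
  of Cabibbo–Marinari OR hits after each HMC update: `∃ τ₀ > 0` such that for every `n ≥ 1`, `ε > 0` with
  `nε ≤ τ₀` the composite converges to `wilsonMeasure (β/N)` geometrically in total variation from every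
  initial law at every time, and the Wilson measure is its unique invariant probability law.

NOT CLAIMED: anything beyond the short-trajectory threshold (the engine's usual `τ ≈ 1` is NOT covered);
any value of `τ₀`, `mm`, `δ`; OMF words / `tau_jitter`; the reverse order (one more line, not written);
floating point and the engine's `k ≤ 10⁻¹²` OR skip (here `k = 0`).
-/

noncomputable section

namespace Summit.Ventures.LatticeQCDFlow.Exactness

open MeasureTheory Measure Set Filter Topology Function ProbabilityTheory ProbabilityTheory.Kernel Metric
open Literature.MathematicalPhysics.QuantumFieldTheory
open Literature.MathematicalPhysics.QuantumLattice (connectedSpace_specialUnitaryGroup fundamentalRep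
  continuous_fundamentalRep)
open scoped ENNReal Matrix Matrix.Norms.Operator NNReal

set_option backward.isDefEq.respectTransparency false

/-! ## §2 The engine's HMC update followed by any exact step -/

section Engine

variable (N : ℕ) [NeZero N] {L : Type*} [Fintype L] {ε : ℝ} {nstep : ℕ}
  {g : (L → Matrix.specialUnitaryGroup (Fin N) ℂ) → L → SUNCoords N}
  {S : (L → Matrix.specialUnitaryGroup (Fin N) ℂ) → ℝ} {b Kg s : ℝ}

/-- **THE ENGINE'S `n`-STEP LEAPFROG HMC FOLLOWED BY ANY EXACT STEP CONVERGES FROM EVERY START, FOR SHORT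
TRAJECTORIES.**  Hypotheses of gen-18's `engine_sunLeapfrogHMCN_uniformlyErgodic` (`n ≥ 1`, `ε > 0`, measurable
increment bounded by `b` and `K_g`-Lipschitz, measurable action bounded by `s`, `nε, (2n+1)b, K_g εn² ≤ s_N`) and
`P` ANY Markov kernel leaving `π_S = Z⁻¹e^{−S}·Haar^{⊗links}` invariant: with `K = P ∘ₖ (HMC update)` there are
`mm` and `δ ∈ (0, 1]` with `|μ₀Kᵗ(A) − π_S(A)| ≤ (1 − δ)^{⌊t/(mm+1)⌋}` for EVERY initial law `μ₀`, every `t`,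
every `A`; and `π_S` is the unique invariant probability law of `K`. -/
theorem engine_sunLeapfrogHMCN_exactStep_uniformlyErgodic (hε : 0 < ε) (hn : 1 ≤ nstep) (hg : Measurable g)
    (hb0 : 0 ≤ b) (hb : ∀ u l, ‖g u l‖ ≤ b) (hK0 : 0 ≤ Kg)
    (hK : ∀ U U', ‖g U - g U'‖ ≤ Kg * ‖coeConfig U - coeConfig U'‖) (hS : Measurable S) (hs : ∀ u, |S u| ≤ s)
    (h1 : nstep * ε ≤ sunShortTrajThreshold (sunCoordι N) (sunCoordι_injective N))
    (h2 : (2 * nstep + 1) * b ≤ sunShortTrajThreshold (sunCoordι N) (sunCoordι_injective N))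
    (h3 : Kg * ε * (nstep : ℝ) ^ 2 ≤ sunShortTrajThreshold (sunCoordι N) (sunCoordι_injective N))
    (P : Kernel (L → Matrix.specialUnitaryGroup (Fin N) ℂ) (L → Matrix.specialUnitaryGroup (Fin N) ℂ)) [IsMarkovKernel P]
    (hP : Invariant P (gibbsProbability (Measure.pi fun _ : L => haarProbability (Matrix.specialUnitaryGroup (Fin N) ℂ))
      (fun u => Real.exp (-S u)))) :
    ∃ mm : ℕ, ∃ δ : ℝ, 0 < δ ∧ δ ≤ 1 ∧
      (∀ (μ₀ : Measure (L → Matrix.specialUnitaryGroup (Fin N) ℂ)) [IsProbabilityMeasure μ₀] (t : ℕ)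
          (A : Set (L → Matrix.specialUnitaryGroup (Fin N) ℂ)),
        |((fun m : Measure (L → Matrix.specialUnitaryGroup (Fin N) ℂ) =>
              m.bind (P ∘ₖ sunLeapfrogHMCN (sunCoordι N) (sunCoordι_skew N) ε (Measure.addHaar : Measure (SUNCoords N))
                (sunKinetic N) hg S nstep))^[t] μ₀).real A
            - (gibbsProbability (Measure.pi fun _ : L => haarProbability (Matrix.specialUnitaryGroup (Fin N) ℂ))
                (fun u => Real.exp (-S u))).real A| ≤ (1 - δ) ^ (t / (mm + 1))) ∧
      ∀ (π' : Measure (L → Matrix.specialUnitaryGroup (Fin N) ℂ)) [IsProbabilityMeasure π'],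
        Invariant (P ∘ₖ sunLeapfrogHMCN (sunCoordι N) (sunCoordι_skew N) ε (Measure.addHaar : Measure (SUNCoords N))
          (sunKinetic N) hg S nstep) π' →
        π' = gibbsProbability (Measure.pi fun _ : L => haarProbability (Matrix.specialUnitaryGroup (Fin N) ℂ))
          (fun u => Real.exp (-S u)) := by
  haveI : ConnectedSpace (Matrix.specialUnitaryGroup (Fin N) ℂ) := connectedSpace_specialUnitaryGroup
  -- the walk minorant of gen-18, in the engine's coordinates
  obtain ⟨δ, hδ, hwalk⟩ := sunLeapfrogHMCN_minorised_walk (sunCoordι N) (sunCoordι_skew N) (sunCoordι_injective N)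
    Measure.addHaar (τ := fun R => Fintype.card L * ((N + 4 * Fintype.card (UpperPair N)) * R ^ 2))
    (sunCoordι_range N) hε hn (measurable_sunKinetic N) (sunKinetic_nonneg N) (sunKinetic_le_of_norm_le N)
    (sunMomentumWeight_sunKinetic_ne_top N Measure.addHaar) hg hb0 hb hK0 hK hS hs h1 h2 h3
  -- the chart kick dominates Haar near `1`, hence the HMC update dominates product Haar on a box
  obtain ⟨V, hV, a, ha, hle⟩ := exists_smul_haar_restrict_le_chartKickR (sunCoordι N) (sunCoordι_skew N)
    Measure.addHaar (sunCoordι_injective N) (sunCoordι_range N) (show 0 < nstep * ε / 3 by positivity)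
  have hcoord : ∀ _j : L, a • (haarProbability (Matrix.specialUnitaryGroup (Fin N) ℂ)).restrict (interior V) ≤
      chartKickR (sunCoordι N) (sunCoordι_skew N) (Measure.addHaar : Measure (SUNCoords N)) (nstep * ε / 3) := fun _ =>
    calc a • (haarProbability (Matrix.specialUnitaryGroup (Fin N) ℂ)).restrict (interior V)
        ≤ a • (haarProbability (Matrix.specialUnitaryGroup (Fin N) ℂ)).restrict V := by
          refine Measure.le_iff'.2 fun A => ?_
          simp only [Measure.smul_apply, smul_eq_mul]
          exact mul_le_mul' le_rfl (Measure.le_iff'.1 (Measure.restrict_mono interior_subset le_rfl) A)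
      _ ≤ _ := hle
  haveI : IsProbabilityMeasure (chartKickR (sunCoordι N) (sunCoordι_skew N) (Measure.addHaar : Measure (SUNCoords N))
      (nstep * ε / 3)) :=
    isProbabilityMeasure_chartKickR (sunCoordι N) (sunCoordι_skew N) Measure.addHaar (show 0 < nstep * ε / 3 by positivity)
  have hbox : ∀ U : L → Matrix.specialUnitaryGroup (Fin N) ℂ,
      (δ * ∏ _j : L, a) • (Measure.pi fun _ : L => haarProbability (Matrix.specialUnitaryGroup (Fin N) ℂ)).restrict
          {W | ∀ j, W j * (U j)⁻¹ ∈ interior V} ≤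
        sunLeapfrogHMCN (sunCoordι N) (sunCoordι_skew N) ε (Measure.addHaar : Measure (SUNCoords N))
          (sunKinetic N) hg S nstep U := fun U =>
    calc (δ * ∏ _j : L, a) • (Measure.pi fun _ : L => haarProbability (Matrix.specialUnitaryGroup (Fin N) ℂ)).restrict
            {W | ∀ j, W j * (U j)⁻¹ ∈ interior V}
        = δ • ((∏ _j : L, a) • (Measure.pi fun _ : L => haarProbability (Matrix.specialUnitaryGroup (Fin N) ℂ)).restrict
            {W | ∀ j, W j * (U j)⁻¹ ∈ interior V}) := by rw [smul_smul]
      _ ≤ δ • mulWalk (Measure.pi fun _ : L => chartKickR (sunCoordι N) (sunCoordι_skew N)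
            (Measure.addHaar : Measure (SUNCoords N)) (nstep * ε / 3)) U := by
          refine Measure.le_iff'.2 fun A => ?_
          simp only [Measure.smul_apply, smul_eq_mul]
          exact mul_le_mul' le_rfl (Measure.le_iff'.1
            (smul_restrict_box_le_mulWalk_pi (μH := haarProbability (Matrix.specialUnitaryGroup (Fin N) ℂ)) hcoord U) A)
      _ ≤ _ := hwalk U
  -- exactness and the Markov property of the HMC update
  have hH : Measurable fun z : (L → Matrix.specialUnitaryGroup (Fin N) ℂ) × (L → SUNCoords N) => S z.1 + sunKinetic N z.2 :=
    (hS.comp measurable_fst).add ((measurable_sunKinetic N).comp measurable_snd)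
  haveI : Fact (Measurable fun z : (L → Matrix.specialUnitaryGroup (Fin N) ℂ) × (L → SUNCoords N) => S z.1 + sunKinetic N z.2) := ⟨hH⟩
  haveI : IsMarkovKernel (sunLeapfrogHMCN (sunCoordι N) (sunCoordι_skew N) ε (Measure.addHaar : Measure (SUNCoords N))
      (sunKinetic N) hg S nstep) := by
    haveI := isProbabilityMeasure_sunMomentumLaw (L := L) (Measure.addHaar : Measure (SUNCoords N)) (sunKinetic N)
      (measurable_sunKinetic N) (sunMomentumWeight_sunKinetic_ne_top N Measure.addHaar)
    unfold sunLeapfrogHMCN; infer_instance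
  have hKinv := sunLeapfrogHMCN_invariant_gibbs (sunCoordι N) (sunCoordι_skew N) (ε := ε) hg (measurable_sunKinetic N)
    (sunMomentumWeight_sunKinetic_ne_top N (Measure.addHaar : Measure (SUNCoords N))) hS nstep
  obtain ⟨hlo, hhi⟩ := gibbsWeight_pinched (L := L) (n := Fin N) hs
  exact exactStep_uniformlyErgodic_of_box_minorised (Real.exp_pos (-s)) hlo hhi hKinv isOpen_interior
    (mem_interior_iff_mem_nhds.2 hV) (mul_ne_zero hδ.ne' (Finset.prod_ne_zero_iff.2 fun _ _ => ha)) hbox P hP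

variable {F : (L → Matrix.specialUnitaryGroup (Fin N) ℂ) → L → SUNCoords N} {Fmax KF : ℝ}

/-- **The same in trajectory-length form for any `C¹` ambient force law** (half kick `−(ε/2)·F(U)`): there is
`τ₀ > 0` such that for EVERY `n ≥ 1` and `ε > 0` with `nε ≤ τ₀`, the HMC update followed by any exact `P`
converges to `π_S` from every initial law at every time and has `π_S` as its unique invariant law. -/
theorem engine_sunLeapfrogHMCN_exactStep_uniformlyErgodic_of_contDiff
    (Pf : (L → Matrix (Fin N) (Fin N) ℂ) → L → SUNCoords N) (hPf : ContDiff ℝ 1 Pf)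
    (hS : Measurable S) (hs : ∀ u, |S u| ≤ s)
    (P : Kernel (L → Matrix.specialUnitaryGroup (Fin N) ℂ) (L → Matrix.specialUnitaryGroup (Fin N) ℂ)) [IsMarkovKernel P]
    (hP : Invariant P (gibbsProbability (Measure.pi fun _ : L => haarProbability (Matrix.specialUnitaryGroup (Fin N) ℂ))
      (fun u => Real.exp (-S u)))) :
    ∃ τ₀ : ℝ, 0 < τ₀ ∧ ∀ (nstep : ℕ) (ε : ℝ) (hn : 1 ≤ nstep) (hε : 0 < ε), nstep * ε ≤ τ₀ →
      ∃ mm : ℕ, ∃ δ : ℝ, 0 < δ ∧ δ ≤ 1 ∧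
        (∀ (μ₀ : Measure (L → Matrix.specialUnitaryGroup (Fin N) ℂ)) [IsProbabilityMeasure μ₀] (t : ℕ)
            (A : Set (L → Matrix.specialUnitaryGroup (Fin N) ℂ)),
          |((fun m : Measure (L → Matrix.specialUnitaryGroup (Fin N) ℂ) =>
                m.bind (P ∘ₖ sunLeapfrogHMCN (sunCoordι N) (sunCoordι_skew N) ε (Measure.addHaar : Measure (SUNCoords N))
                  (sunKinetic N) (measurable_halfKick_sun N (measurable_sunForce_of_continuous Pf hPf.continuous) ε)
                  S nstep))^[t] μ₀).real A
              - (gibbsProbability (Measure.pi fun _ : L => haarProbability (Matrix.specialUnitaryGroup (Fin N) ℂ))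
                  (fun u => Real.exp (-S u))).real A| ≤ (1 - δ) ^ (t / (mm + 1))) ∧
        ∀ (π' : Measure (L → Matrix.specialUnitaryGroup (Fin N) ℂ)) [IsProbabilityMeasure π'],
          Invariant (P ∘ₖ sunLeapfrogHMCN (sunCoordι N) (sunCoordι_skew N) ε (Measure.addHaar : Measure (SUNCoords N))
            (sunKinetic N) (measurable_halfKick_sun N (measurable_sunForce_of_continuous Pf hPf.continuous) ε) S nstep) π' →
          π' = gibbsProbability (Measure.pi fun _ : L => haarProbability (Matrix.specialUnitaryGroup (Fin N) ℂ))
            (fun u => Real.exp (-S u)) := by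
  obtain ⟨Fmax, KF, hF0, hKF0, hFb, hFK⟩ := sunForce_bounds_of_contDiff Pf hPf
  set s₀ := sunShortTrajThreshold (sunCoordι N) (sunCoordι_injective N) with hs₀
  have hs₀0 : 0 < s₀ := sunShortTrajThreshold_pos _ _
  refine ⟨min s₀ (min (s₀ / (3 * Fmax + 1)) (Real.sqrt (s₀ / (KF + 1)))),
    lt_min hs₀0 (lt_min (by positivity) (Real.sqrt_pos.2 (by positivity))), fun nstep ε hn hε hτ => ?_⟩
  obtain ⟨h1, h2, h3⟩ := trajLength_threshold_arith hs₀0 hF0 hKF0 hn hε rfl hτ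
  refine engine_sunLeapfrogHMCN_exactStep_uniformlyErgodic N hε hn
    (measurable_halfKick_sun N (measurable_sunForce_of_continuous Pf hPf.continuous) ε) (b := ε / 2 * Fmax)
    (Kg := ε / 2 * KF) (by positivity) (fun U l => ?_) (by positivity) (fun U U' => ?_) hS hs h1 h2 h3 P hP
  · rw [Pi.smul_apply, norm_smul, Real.norm_eq_abs, abs_neg, abs_of_pos (by positivity)]
    exact mul_le_mul_of_nonneg_left (hFb U l) (by positivity)
  · have hsub : (-(ε / 2)) • Pf (coeConfig U) - (-(ε / 2)) • Pf (coeConfig U') = (-(ε / 2)) • (Pf (coeConfig U) - Pf (coeConfig U')) := by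
      funext l; simp only [Pi.sub_apply, Pi.smul_apply, smul_sub]
    rw [hsub, norm_smul, Real.norm_eq_abs, abs_neg, abs_of_pos (by positivity), mul_assoc]
    exact mul_le_mul_of_nonneg_left (hFK U U') (by positivity)

end Engine

/-! ## §3 The engine's `'hmc' + n_or × 'or'` composite as run -/

section Wilson

variable (N : ℕ) [NeZero N] {d L : ℕ} [NeZero L] {m : Type*} [Fintype m] [DecidableEq m]

omit [NeZero N] [NeZero L] in
/-- The OR file's defining representation IS the Literature's fundamental representation. -/
theorem suRep_eq_fundamentalRep : suRep N = fundamentalRep (Fin N) := rfl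

/-- **THE ENGINE'S `'hmc' + n_or × 'or'` COMPOSITE AS RUN CONVERGES TO THE WILSON MEASURE FROM EVERY START, FOR
SHORT TRAJECTORIES.**  Torus `(ℤ/L)^d` with `L ≥ 2`, `SU(N)` (`N ≥ 1`), any real `β`; one `n`-step leapfrog HMC
update with the engine's momenta, kinetic term `−Σ tr P²`, half kicks by THE ENGINE'S WILSON FORCE
`(β/2N)·TA(U_e R_e(U))` and Metropolis test on `(β/N)·S_W + T`, followed by ANY schedule `sched` of
Cabibbo–Marinari over-relaxation hits.  There is `τ₀ > 0` (depending on `N, d, L, β` only; not computed) such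
that for EVERY `n ≥ 1` and `ε > 0` with `nε ≤ τ₀` there are `mm` and `δ ∈ (0, 1]` with
`|μ₀Kᵗ(A) − wilsonMeasure (β/N) (A)| ≤ (1 − δ)^{⌊t/(mm+1)⌋}` for EVERY initial law `μ₀`, every `t`, every `A`,
and the Wilson measure is the ONLY invariant probability law of the composite `K`. -/
theorem wilson_sunWilsonForceHMCN_orSweep_uniformlyErgodic (hL : 2 ≤ L) (β : ℝ)
    (sched : List (Edge d L × (Fin N ≃ Fin 2 ⊕ m))) :
    ∃ τ₀ : ℝ, 0 < τ₀ ∧ ∀ (nstep : ℕ) (ε : ℝ) (hn : 1 ≤ nstep) (hε : 0 < ε), nstep * ε ≤ τ₀ →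
      ∃ mm : ℕ, ∃ δ : ℝ, 0 < δ ∧ δ ≤ 1 ∧
        (∀ (μ₀ : Measure (GaugeConfig d L (Matrix.specialUnitaryGroup (Fin N) ℂ))) [IsProbabilityMeasure μ₀]
            (t : ℕ) (A : Set (GaugeConfig d L (Matrix.specialUnitaryGroup (Fin N) ℂ))),
          |((fun μ' : Measure (GaugeConfig d L (Matrix.specialUnitaryGroup (Fin N) ℂ)) =>
                μ'.bind (cmORSweep sched ∘ₖ sunLeapfrogHMCN (sunCoordι N) (sunCoordι_skew N) ε
                  (Measure.addHaar : Measure (SUNCoords N)) (sunKinetic N)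
                  (measurable_halfKick_sun N (measurable_sunWilsonForceLaw_coeConfig N (d := d) (L := L) β) ε)
                  (fun U => β / N * wilsonAction (fundamentalRep (Fin N)) U) nstep))^[t] μ₀).real A
              - (wilsonMeasure (d := d) (L := L) (fundamentalRep (Fin N)) (β / N)).real A| ≤ (1 - δ) ^ (t / (mm + 1))) ∧
        ∀ (π' : Measure (GaugeConfig d L (Matrix.specialUnitaryGroup (Fin N) ℂ))) [IsProbabilityMeasure π'],
          Invariant (cmORSweep sched ∘ₖ sunLeapfrogHMCN (sunCoordι N) (sunCoordι_skew N) ε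
            (Measure.addHaar : Measure (SUNCoords N)) (sunKinetic N)
            (measurable_halfKick_sun N (measurable_sunWilsonForceLaw_coeConfig N (d := d) (L := L) β) ε)
            (fun U => β / N * wilsonAction (fundamentalRep (Fin N)) U) nstep) π' →
          π' = wilsonMeasure (d := d) (L := L) (fundamentalRep (Fin N)) (β / N) := by
  obtain ⟨s, hs⟩ := exists_bound_smul_wilsonAction_sun N (d := d) (L := L) (fundamentalRep (Fin N))
    (continuous_fundamentalRep (Fin N)) (β / N)
  -- the OR schedule leaves the Gibbs law of `(β/N)·S_W` invariant
  have hP : Invariant (cmORSweep (d := d) (L := L) sched)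
      (gibbsProbability (Measure.pi fun _ : Edge d L => haarProbability (Matrix.specialUnitaryGroup (Fin N) ℂ))
        fun U : GaugeConfig d L (Matrix.specialUnitaryGroup (Fin N) ℂ) =>
          Real.exp (-(β / N * wilsonAction (fundamentalRep (Fin N)) U))) := by
    have h : (fun U : GaugeConfig d L (Matrix.specialUnitaryGroup (Fin N) ℂ) =>
        Real.exp (-(β / N * wilsonAction (fundamentalRep (Fin N)) U))) =
        fun U => Real.exp (-(β / N) * wilsonAction (suRep N) U) := by
      funext U; rw [neg_mul, suRep_eq_fundamentalRep]
    rw [h]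
    exact cmORSweep_invariant_gibbsProbability N hL (β / N) sched
  rw [← gibbsProbability_smul_wilsonAction_eq N (d := d) (L := L) (fundamentalRep (Fin N)) (β / N)]
  exact engine_sunLeapfrogHMCN_exactStep_uniformlyErgodic_of_contDiff N (sunWilsonForceLaw N β)
    (contDiff_sunWilsonForceLaw N β) (measurable_engineWilsonAction N β) hs (cmORSweep sched) hP

end Wilson

end Summit.Ventures.LatticeQCDFlow.Exactness
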